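import Summits.CriticalPhenomena.PercolationContinuityZ3.Theorems.PercNearOneGluingNoHeavyConstsChainRuleLocalPeel
import HarnessLib
import HarnessLib.Audit.Tags

/-!
# The STAR PEEL at an avoided vertex: `K(S, T ∪ {y})` expanded over the states of all pairs at `y`
# (infrastructure for the vertex-profile reduction of the single-edge chain rule; PAPER-2 track (ii))

builds on p205010 (kernel theorem, internal audit signed; external expert review pending).  Support file (`--supports
stmt-CriticalPhenomena-4575`), seat `prim-consts-2` (gen 8); memo `run/shared/lean/prim/consts/FROM-prim-consts-2-g8-STAR-PEEL.md` §3.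
No definitions, no named facts, no sorries; standard axioms.

van den Berg–Häggström–Kahn's identity (6): conditioning on the set `Z` of vertices joined to the avoided vertex `y` by an open pair turns
"`S` avoids `T ∪ {y}`" into "`S` avoids `T ∪ Z` in the graph with the pairs at `y` deleted".  With `M ∌ y` a finite set of neighbours and
`q_t = w(s(y,t))`:

* `Consts.avoidSdiff_insert_starPeel` — for pairs `s(y,t)`, `t ∈ M`, not yet deleted from `F`:
  `μ{S ↮ T∪{y} in ω∖F} = Σ_{Z ⊆ M} (∏_{t∈Z} q_t)(∏_{t∈M∖Z} (1 − q_t)) · μ{S ↮ T∪{y}∪Z in ω∖(F ∪ {s(y,t) : t ∈ M})}` (iterate the one-pair pivot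
  `Consts.avoidSdiff_pivot'`, p309802);
* `Consts.real_avoid_insert_starPeel` — if moreover every pair at `y` towards a vertex outside `M` has weight `0` and `y ∉ S`, then
  `K_w(S, T ∪ {y}) = Σ_{Z ⊆ M} (∏_{t∈Z} q_t)(∏_{t∈M∖Z} (1 − q_t)) · K_{w⁰}(S, T ∪ Z)`, `w⁰ = w` switched off at the pairs `s(y,t)`, `t ∈ M`
  (afterwards `y` is a.s. isolated and is dropped: `Consts.real_avoid_insert_of_isolated`).  `M = {z}` is `Consts.real_avoid_insert_pendant` (p313189).
Applied to the three columns of the chain minor `D(G;{y})` (three independent copies, one per column) this is the Y-PEEL of the memo (§3.1):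
`D(G;{y})` is a trinomial-Bernstein combination, in the weights `q_t`, of the vertex-profile sums `Σ det[K_{w⁰}(S_i, A_j ∪ Z_j)]` — whose positivity for
profiles without a common vertex (conjecture VP₀) implies `Consts.SingleEdgeChainRule` (memo §3.2, Theorem K of the P2 sheet).
[cite: VandenbergHaggstromKahn2005, Thm. 1.1 proof, display (6) (pp. 4–5)] [cite: Grimmett1999, §2.2]
-/

noncomputable section

namespace Summit.CriticalPhenomena.PercolationContinuityZ3.Theorems

open MeasureTheory Set Literature.Probability.LatticeModels Literature.Probability.Percolation
open scoped Classical

namespace Consts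

/-- Notation (this file only): the disconnection kernel `𝕂[w](S, T) = μ_w{S ↮ T}`. -/
local notation3 "𝕂[" w "](" S ", " T ")" =>
  MeasureTheory.Measure.real (prodBernoulli w) {ω | ∀ s ∈ S, ∀ t ∈ T, ¬ (openGraph ω).Reachable s t}

/-- Notation (this file only): disconnection read in the configuration with the pairs `F` deleted. -/
local notation3 "𝔸[" w "](" F ", " S ", " T ")" =>
  MeasureTheory.Measure.real (prodBernoulli w) {ω : BondConfig _ | ∀ s ∈ S, ∀ t ∈ T, ¬ (openGraph (ω \ F)).Reachable s t}

variable {V : Type*} [Fintype V]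

/-- **The star peel (all pairs at the avoided vertex `y` towards a finite set `M` of neighbours).**  For `y ∉ M` and pairs
`s(y,t)`, `t ∈ M`, not yet deleted:
`μ{S ↮ T∪{y} in ω∖F} = Σ_{Z ⊆ M} (∏_{t∈Z} w(yt)) (∏_{t∈M∖Z} (1 − w(yt))) · μ{S ↮ T∪{y}∪Z in ω∖(F ∪ {s(y,t) : t ∈ M})}`
(iterate the one-pair pivot `Consts.avoidSdiff_pivot'`). [cite: VandenbergHaggstromKahn2005, Thm. 1.1 proof, display (6) (pp. 4–5)] -/
theorem avoidSdiff_insert_starPeel (w : Sym2 V → unitInterval) (S : Set V) (y : V) (M : Finset V) (hyM : y ∉ M) :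
    ∀ (F : Set (Sym2 V)) (T : Set V), (∀ t ∈ M, s(y, t) ∉ F) →
      𝔸[w](F, S, insert y T) =
        ∑ Z ∈ M.powerset, ((∏ t ∈ Z, (w s(y, t) : ℝ)) * (∏ t ∈ M \ Z, (1 - (w s(y, t) : ℝ)))) *
          𝔸[w](F ∪ ((M.image fun t => s(y, t)) : Set (Sym2 V)), S, insert y (T ∪ (Z : Set V))) := by
  classical
  induction M using Finset.induction_on with
  | empty =>
    intro F T _
    simp
  | @insert t M ht IH =>
    intro F T hF
    have hyt : y ≠ t := fun h => hyM (h ▸ Finset.mem_insert_self t M)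
    have hyM' : y ∉ M := fun h => hyM (Finset.mem_insert_of_mem h)
    have he : s(y, t) ∉ F := hF t (Finset.mem_insert_self t M)
    -- pivot the pair `yt`
    rw [avoidSdiff_pivot' w F S T hyt he]
    -- the remaining pairs are not deleted yet
    have hF' : ∀ t' ∈ M, s(y, t') ∉ insert s(y, t) F := by
      intro t' ht' h
      rcases mem_insert_iff.1 h with h | h
      · exact ht ((Sym2.congr_right.1 h) ▸ ht')
      · exact hF t' (Finset.mem_insert_of_mem ht') h
    rw [IH hyM' (insert s(y, t) F) (insert t T) hF', IH hyM' (insert s(y, t) F) T hF']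
    -- regroup the sum over subsets of `insert t M`
    rw [Finset.sum_powerset_insert ht]
    have hFimg : (F ∪ (((insert t M).image fun t' => s(y, t')) : Set (Sym2 V))) =
        insert s(y, t) F ∪ ((M.image fun t' => s(y, t')) : Set (Sym2 V)) := by
      ext e; simp only [Finset.coe_image, Finset.coe_insert, Set.image_insert_eq, mem_union, mem_insert_iff, mem_image,
        Finset.mem_coe]; tauto
    rw [hFimg, Finset.mul_sum, Finset.mul_sum, add_comm]
    congr 1
    · -- subsets not containing `t`: factor `1 − w(yt)`
      refine Finset.sum_congr rfl fun Z hZ => ?_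
      have hZM : Z ⊆ M := Finset.mem_powerset.1 hZ
      have htZ : t ∉ Z := fun h => ht (hZM h)
      have hsd : insert t M \ Z = insert t (M \ Z) := by
        ext a; simp only [Finset.mem_sdiff, Finset.mem_insert]
        constructor
        · rintro ⟨h1 | h1, h2⟩
          · exact Or.inl h1
          · exact Or.inr ⟨h1, h2⟩
        · rintro (h1 | ⟨h1, h2⟩)
          · exact ⟨Or.inl h1, fun h => htZ (h1 ▸ h)⟩
          · exact ⟨Or.inr h1, h2⟩
      have htMZ : t ∉ M \ Z := fun h => ht (Finset.mem_sdiff.1 h).1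
      rw [hsd, Finset.prod_insert htMZ]
      ring
    · -- subsets containing `t`: factor `w(yt)`
      refine Finset.sum_congr rfl fun Z hZ => ?_
      have hZM : Z ⊆ M := Finset.mem_powerset.1 hZ
      have htZ : t ∉ Z := fun h => ht (hZM h)
      have hsd : insert t M \ insert t Z = M \ Z := by
        ext a; simp only [Finset.mem_sdiff, Finset.mem_insert]
        constructor
        · rintro ⟨h1 | h1, h2⟩
          · exact absurd (Or.inl h1) h2
          · exact ⟨h1, fun h => h2 (Or.inr h)⟩
        · rintro ⟨h1, h2⟩
          exact ⟨Or.inr h1, fun h => h.elim (fun h' => ht (h' ▸ h1)) h2⟩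
      have hT : insert y (insert t T ∪ (Z : Set V)) = insert y (T ∪ ((insert t Z : Finset V) : Set V)) := by
        ext a; simp only [mem_insert_iff, mem_union, Finset.coe_insert, Finset.mem_coe]; tauto
      rw [hsd, Finset.prod_insert htZ, hT]
      ring

/-- **The star peel of a kernel entry.**  If `y ∉ S`, `y ∉ M` and every pair `s(y,t)` with `t ∉ M`, `t ≠ y` has weight `0`, then
`K_w(S, T ∪ {y}) = Σ_{Z ⊆ M} (∏_{t∈Z} w(yt)) (∏_{t∈M∖Z} (1 − w(yt))) · K_{w⁰}(S, T ∪ Z)` with `w⁰ = w` switched off at `{s(y,t) : t ∈ M}`.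
[cite: VandenbergHaggstromKahn2005, Thm. 1.1 proof, display (6) (pp. 4–5)] -/
theorem real_avoid_insert_starPeel (w : Sym2 V → unitInterval) (S T : Set V) (y : V) (M : Finset V) (hyM : y ∉ M) (hyS : y ∉ S)
    (hsupp : ∀ t, t ≠ y → t ∉ M → w s(y, t) = 0) (F : Set (Sym2 V)) (hF : F = ((M.image fun t => s(y, t)) : Set (Sym2 V))) :
    𝕂[w](S, insert y T) =
      ∑ Z ∈ M.powerset, ((∏ t ∈ Z, (w s(y, t) : ℝ)) * (∏ t ∈ M \ Z, (1 - (w s(y, t) : ℝ)))) *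
        𝕂[fun e => if e ∈ F then 0 else w e](S, T ∪ (Z : Set V)) := by
  classical
  have h0 : ∀ t ∈ M, s(y, t) ∉ (∅ : Set (Sym2 V)) := fun _ _ h => h
  rw [← avoidSdiff_empty w S (insert y T), avoidSdiff_insert_starPeel w S y M hyM ∅ T h0, Set.empty_union, ← hF]
  have hzero : ∀ t, t ≠ y → (fun e : Sym2 V => if e ∈ F then (0 : unitInterval) else w e) s(y, t) = 0 := by
    intro t hty
    show (if s(y, t) ∈ F then (0 : unitInterval) else w s(y, t)) = 0
    split_ifs with h
    · rfl
    · have htM : t ∉ M := by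
        intro htM; apply h; rw [hF]
        exact Finset.mem_coe.2 (Finset.mem_image.2 ⟨t, htM, rfl⟩)
      exact hsupp t hty htM
  refine Finset.sum_congr rfl fun Z _ => ?_
  rw [avoidSdiff_eq_kernel,
    real_avoid_insert_of_isolated (fun e : Sym2 V => if e ∈ F then (0 : unitInterval) else w e) S _ hyS hzero]

end Consts

end Summit.CriticalPhenomena.PercolationContinuityZ3.Theorems

end
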